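import Summits.QuantumFields.YangMills.Theorems.BalabanUVNodesN19TameConditionedHellingerLetterAlongK
import Literature.MathematicalPhysics.QuantumFieldTheory.Balaban1983to89.T4DilationKPLog

/-!
# BalabanUVNodes ∕ node N19 (NE7) — THE TAME TILT LETTER FROM A ONE-RUN KOTECKÝ–PREISS MARGIN: the abstract (KR)+(V‑b) hypotheses DISCHARGE the
# `htilt` binder of `affinityDefectLetter_of_tameTilts`; with R2's tame families this gives the (H) letter from (KR)+(V‑a)+(V‑b) — importable

Cell `pub-ymgap` (HUMAN RULING D-0062 Track A ∕ director-ym R399 (3a) second-wave width seats), WIDTH SEAT `pub-ymgap-dag-n19-w4` (node n19 = NE7),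
generation g6, CLAIM-2 ∕ INTENT-2 (bus 2026-08-28T08:59Z).  Route `Summits/QuantumFields/YangMills/Theses/BalabanUVNodes.lean`, key item K3⁷
`SpineGivenEndpointR13SepCoPH` (stmt-QuantumFields-20544; skeleton of record v5 941dddb108cbaacf, stub 2 `stub_expansion13H`); filed
`--kind proof --supports … --as helper`.  COUNT-NEUTRAL.  THEOREMS ONLY (0 `def`, 0 `instance`, 0 `notation`, 0 `sorry`).  ADDITIVE — imports this seat's
`…N19TameConditionedHellingerLetterAlongK` (p618979: `one_sub_affinity_classLaw_le_wildMass_add_tameTilts`, `affinityDefectLetter_of_tameTilts` BY NAME) and the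
tree's `Literature.…Balaban1983to89.T4DilationKPLog` (`logZ_differentiableOn_and_bound`, `T4DilationKP.cZ ∕ IsKPOn`, `ClusterExpansion.exp_polymerLogZ_of_kp`,
`polymerLogZ` BY NAME — the tree's kernel-proved Kotecký–Preiss logarithm); modifies nothing, re-declares nothing.

WHY.  FILES 1a∕1b of this seat (p618660 ∕ p618979) put idea-3's edition-3∕4 V-side kernel with CRIT-1 g5's rider R2 in `Theorems/`: the one-`(K,t)` Hellinger
letter and its K-summation take as INPUT an analytic-tilt letter `htilt` for the TAME-RESTRICTED class sums of the two runs (`∃ φ_A φ_B` complex-differentiable on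
`|s| ≤ r_K`, `e^{φ} =` tilted restricted class sum ∕ restricted class sum, `‖φ‖ ≤ 𝔅`).  Idea-3 ed.3 §12 (`tilt_classSum_eq_cZ`, `isKPOn_tilt`,
`variance_le_of_multiplicative_kp` — kernel-checked in `Cruxes/SpineGivenEndpointR13SepCoPH/HellingerRoadSketch.lean`, NOT importable) and CRIT-1's ed.3 sheet
check 4 («`tilt_classSum_eq_cZ` and `isKPOn_tilt` apply THERE [on `Λ ∖ (over-aged)`], where `|u_γ| ≤ η_K·size γ` is exactly (V‑b)») say where that letter
comes from: the STRUCTURAL READING (KR) — keyed class weights MULTIPLICATIVE over a run's large-field components, increment ADDITIVE — plus a ONE-RUN weighted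
Kotecký–Preiss margin absorbing the tilt factor.  THIS FILE makes that supply an importable theorem and docks it into FILE 1b:
* §1 `tilt_classSum_eq_cZ` (∕ `_of_additive`) — `Σ_{X ⊆ Λ compatible}(∏_{γ∈X} a_γ)e^{sΣ_{γ∈X}u_γ} = Z(Λ; a_γe^{su_γ})` (`T4DilationKP.cZ`); `logRatio_prod_eq_sum` — with
  BOTH runs multiplicative over the same keyed components the two-run increment `h = log B − log A` is additive FOR FREE, `u_γ = log b_γ − log a_γ`.
* §2 `isKPOn_tilt` — `Σ_{γ'∼γ} a_γ' e^{r|u_γ'|} e^{asz γ'} ≤ asz γ` on `Λ` ⇒ `IsKPOn` for `a_γe^{su_γ}` on `|s| ≤ r` ((V‑b) is spent on the RADIUS: `r = r₀∕η`).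
* §3 ★★ `tiltLetter_of_kpMargin` — ONE run: `∃ φ` differentiable on `closedBall 0 r`, `e^{φ(s)} = Σ_X A_X e^{s h_X}∕Σ_X A_X`, `‖φ‖ ≤ 2Σ_Λ asz` — LITERALLY one run's
  half of p618979's `htilt` conjunct with `𝔅 := 2Σ asz` (`φ` = the difference of the tree's `polymerLogZ` at `s` and `0`).
* §4 `tameFamilies_eq_compatible_sdiff` — R2's tame class set (`T ∖ W`, `W` = compatible families MEETING the over-aged set `O`) IS the class set of the
  hard-core gas on `Λ ∖ O`; `wildFamilies_subset`.
* §5 ★★★ `one_sub_affinity_keyedGas_le_wildMass_add_kpMargins` — ONE `(K,t)`, both runs: activities `a, b > 0` on `Λ`, over-aged set `O`, weighted KP margins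
  for `a` and for `b` on `Λ ∖ O` at radius `r` absorbing `e^{r|log b_γ − log a_γ|}`, tame regime ⇒
  `1 − Σ_T √(p_A p_B) ≤ max(p_A(wild), p_B(wild)) + (Σ_{Λ∖O} asz_A + Σ_{Λ∖O} asz_B)∕r²` (p618979 §1 ∘ §3 ∘ §4).
* §6 ★★ `affinityDefectLetter_of_kpMargins` — ALONG `K`: per-key polymer data, the two KP margins on `Λ_K ∖ O_{K,t}` at radii `r_K` (`Σ1∕r_K < ∞`), ONE bound
  `𝔄 ≥ Σ_{Λ_K∖O} asz` (both runs, all keys), wild masses `Σ√wm_K < ∞`, tame regime from `K₀` ⇒ the (H) letter `∃ η ≥ 0, Σ√η_K < ∞, 1 − 𝒜_K(t) ≤ η_K`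
  (p618979 §2 with `𝔅 := 2𝔄`) — i.e. (KR) + (V‑a) + (V‑b) IN ABSTRACT FORM ⇒ the per-key letter the landed class-law ∕ TV roads consume (dag-n19-w2 p612301,
  dag-n20-w4 p609004 `exists_hybridNE7_of_target_of_classLawTV`, dag-n20-w5's endpoint road).  Nothing else enters the V-side.  The wild-mass block
  `(wm, hwildA, hwildB, Σ√wm < ∞)` stays a HYPOTHESIS here; its (V‑a) discharge from the tree's persistent-history count is dag-n20-w4 g3's CLAIM-1
  `…N20WildMassLetterOfPersistentHistoryCount` (bus 2026-08-28T09:10Z) — disjoint, cited by name, not restated.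
* §7 toy (A6): no polymers — the antecedent of §5 is inhabited.
CREDIT.  §1–§2 statements and proofs follow idea-3 g12's Sketch §12 (`YMNodeOIdeate.Idea3.HellingerRoad.tilt_classSum_eq_cZ ∕ isKPOn_tilt`, Cruxes workfile
9a3cb4ec16d8719f) — re-proved, not imported; the tame-sub-gas reading is CRIT-1 g5's (sheet ed.3, check 4; idea-3 card ed.5); the KP logarithm is the tree's.

HONEST FRAMING.  [folklore] algebra + the tree's kernel-proved KP logarithm BY NAME, on hypothesis SHAPES; the multiplicative ∕ additive keyed structure (KR) is a
STRUCTURAL READING of [LF‑II] (1.79)–(1.83) that is NOT typed against the datum of record (typable only once plan v6 exposes the keyed carriers at `wkey`); the KP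
margins with the absorbed tilt factor ((V‑b) = (YG), two-run, UNPRINTED for d = 4), the wild-mass summability ((V‑a), paper-read only) and the regime are
HYPOTHESES produced by nobody; NO estimate of Bałaban's programme is proved; nothing of Bałaban's asserted or instantiated (no `Provisos₁₃CoPH` tuple — K0⁷ OPEN);
NE7 ∕ NE7b ∕ NE7c NOT PRINTED as two-run statements for d = 4 and NOT proved; N19 ∕ N20 ∕ N21 NOT discharged; K3⁷ OPEN, v5 STANDS, not claimed; no summit
statement is proved by this seat; counts UNMOVED (typed 28∕28 · discharged 5∕27, A 5∕28).  One finite four-torus programme at fixed ε — NOT ℝ⁴, NOT infinite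
volume, NOT OS, NOT a mass gap, NOT the Clay problem (R4 closes the conditional finite-𝕋⁴ rung `BalabanLadder.UV` only).  0 `def`; 0 `sorry`; standard axioms;
no cite tags.
-/

noncomputable section

namespace Summit.QuantumFields.YangMills.BalabanUVNodes.N19TameTiltLetterOfKPMargin

open Finset
open Literature.Probability.LatticeModels (IsCompatible polymerPartitionFunction kpTerm IsKPVolume polymerLogZ exp_polymerLogZ_of_kp
  IsCompatible.mono)
open Literature.MathematicalPhysics.QuantumFieldTheory.Balaban1983to89.T4DilationKP (IsKPOn cZ)
open Literature.MathematicalPhysics.QuantumFieldTheory.Balaban1983to89.T4DilationKPLog (logZ_differentiableOn_and_bound)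
open Summit.QuantumFields.YangMills.BalabanUVNodes.N19TameConditionedHellingerLetterAlongK
  (one_sub_affinity_classLaw_le_wildMass_add_tameTilts affinityDefectLetter_of_tameTilts)

variable {P : Type*} [DecidableEq P] (inc : P → P → Prop) [DecidableRel inc]

/-! ## §1 Multiplicative keyed class weights + additive increment ⇒ the tilted class sum IS a polymer partition function [algebra] -/

/-- **MULTIPLICATIVE CLASS WEIGHTS + ADDITIVE INCREMENT ⇒ THE TILT IS A POLYMER PARTITION FUNCTION** [algebra; idea-3 ed.3 §12 `tilt_classSum_eq_cZ`,
importable form]: `Σ_{X ⊆ Λ compatible} (∏_{γ∈X} a_γ)·e^{s·Σ_{γ∈X} u_γ} = Z(Λ; γ ↦ a_γ e^{s u_γ})` (`T4DilationKP.cZ`). -/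
theorem tilt_classSum_eq_cZ (Λ : Finset P) (a u : P → ℝ) (s : ℂ) :
    ∑ X ∈ Λ.powerset with IsCompatible inc X,
        ((∏ γ ∈ X, a γ : ℝ) : ℂ) * Complex.exp (s * ((∑ γ ∈ X, u γ : ℝ) : ℂ))
      = cZ inc (fun γ s => (a γ : ℂ) * Complex.exp (s * (u γ : ℂ))) Λ s := by
  -- adapted from Cruxes/SpineGivenEndpointR13SepCoPH/HellingerRoadSketch.lean §12 (idea-3 g12)
  simp only [cZ, polymerPartitionFunction, Finset.sum_filter]
  refine Finset.sum_congr rfl fun X _ => ?_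
  split_ifs with hc
  · push_cast
    rw [Finset.prod_mul_distrib, ← Complex.exp_sum, ← Finset.mul_sum]
  · rfl

/-- The same with a class-indexed increment `h` that is ADDITIVE on the compatible families [algebra]. -/
theorem tilt_classSum_eq_cZ_of_additive (Λ : Finset P) (a u : P → ℝ) (h : Finset P → ℝ)
    (hh : ∀ X ∈ Λ.powerset.filter (fun X => IsCompatible inc X), h X = ∑ γ ∈ X, u γ) (s : ℂ) :
    ∑ X ∈ Λ.powerset with IsCompatible inc X, ((∏ γ ∈ X, a γ : ℝ) : ℂ) * Complex.exp (s * (h X : ℂ))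
      = cZ inc (fun γ s => (a γ : ℂ) * Complex.exp (s * (u γ : ℂ))) Λ s := by
  rw [← tilt_classSum_eq_cZ inc Λ a u s]
  exact Finset.sum_congr rfl fun X hX => by rw [hh X hX]

omit [DecidableEq P] in
/-- **WITH BOTH RUNS MULTIPLICATIVE OVER THE SAME KEYED COMPONENTS, THE TWO-RUN INCREMENT `h = log B − log A` IS ADDITIVE FOR FREE** [algebra]:
`log ∏_{γ∈X} b_γ − log ∏_{γ∈X} a_γ = Σ_{γ∈X} (log b_γ − log a_γ)` — the local increments are `u_γ = log b_γ − log a_γ`; no extra letter. -/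
theorem logRatio_prod_eq_sum (X : Finset P) {a b : P → ℝ} (ha : ∀ γ ∈ X, 0 < a γ) (hb : ∀ γ ∈ X, 0 < b γ) :
    Real.log (∏ γ ∈ X, b γ) - Real.log (∏ γ ∈ X, a γ) = ∑ γ ∈ X, (Real.log (b γ) - Real.log (a γ)) := by
  rw [Real.log_prod (s := X) (f := b) fun γ hγ => (hb γ hγ).ne', Real.log_prod (s := X) (f := a) fun γ hγ => (ha γ hγ).ne', ← Finset.sum_sub_distrib]

/-! ## §2 A weighted real KP margin ⇒ KP for the tilted activities on the disc [folklore] -/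

omit [DecidableEq P] in
/-- **WEIGHTED REAL KP ⇒ KP FOR THE TILTED ACTIVITIES ON THE DISC** [folklore; idea-3 ed.3 §12 `isKPOn_tilt`, importable form]: if
`Σ_{γ'∼γ} a_γ' e^{r|u_γ'|} e^{asz γ'} ≤ asz γ` on `Λ` (the run's activities absorb the tilt factor `e^{r|u|}` — with `|u_γ| ≤ η·size γ` and `r = r₀∕η` that
factor is `e^{r₀·size γ}`, paid by the run's OWN exponential margin), then `γ ↦ a_γ e^{s u_γ}` is `IsKPOn` on `|s| ≤ r` with the same size function. -/
theorem isKPOn_tilt (Λ : Finset P) (a u asz : P → ℝ) (ha : ∀ γ ∈ Λ, 0 ≤ a γ) {r : ℝ}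
    (hKPw : ∀ γ ∈ Λ, ∑ γ' ∈ Λ with inc γ' γ, a γ' * Real.exp (r * |u γ'|) * Real.exp (asz γ') ≤ asz γ) :
    IsKPOn inc (fun γ s => (a γ : ℂ) * Complex.exp (s * (u γ : ℂ))) asz Λ (Metric.closedBall 0 r) := by
  -- adapted from Cruxes/SpineGivenEndpointR13SepCoPH/HellingerRoadSketch.lean §12 (idea-3 g12)
  intro s hs γ hγ
  refine le_trans (Finset.sum_le_sum fun γ' hγ' => ?_) (hKPw γ hγ)
  have hγ'Λ : γ' ∈ Λ := (Finset.mem_filter.1 hγ').1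
  simp only [kpTerm]
  refine mul_le_mul_of_nonneg_right ?_ (Real.exp_nonneg _)
  rw [norm_mul, Complex.norm_real, Real.norm_eq_abs, abs_of_nonneg (ha γ' hγ'Λ), Complex.norm_exp]
  refine mul_le_mul_of_nonneg_left (Real.exp_le_exp.2 ?_) (ha γ' hγ'Λ)
  rw [Complex.mul_re, Complex.ofReal_re, Complex.ofReal_im, mul_zero, sub_zero]
  calc s.re * u γ' ≤ |s.re * u γ'| := le_abs_self _
    _ = |s.re| * |u γ'| := abs_mul _ _
    _ ≤ ‖s‖ * |u γ'| := mul_le_mul_of_nonneg_right (Complex.abs_re_le_norm s) (abs_nonneg _)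
    _ ≤ r * |u γ'| := mul_le_mul_of_nonneg_right (mem_closedBall_zero_iff.1 hs) (abs_nonneg _)

/-! ## §3 The tame tilt letter from a one-run KP margin [folklore, on the tree's kernel-proved KP logarithm] -/

/-- **★★ THE TILT LETTER FROM A ONE-RUN KP MARGIN** [folklore; the tree's `T4DilationKPLog.logZ_differentiableOn_and_bound` + `exp_polymerLogZ_of_kp` BY NAME].
ONE run: positive activities `a` on a finite polymer family `Λ`, local increments `u`, a weighted real KP margin at radius `r ≥ 0`
(`Σ_{γ'∼γ} a_γ' e^{r|u_γ'|} e^{asz γ'} ≤ asz γ`), and a class-indexed increment `h` additive on compatible families (`h X = Σ_{γ∈X} u_γ`).  Then there is ONE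
BRANCH `φ` of the logarithm of the `h`-tilted normalised class sum of the multiplicative class weights `A_X = ∏_{γ∈X} a_γ`,
`e^{φ(s)} = Σ_X A_X e^{s h_X} ∕ Σ_X A_X`, complex-differentiable on `|s| ≤ r` with `‖φ‖ ≤ 2·Σ_{γ∈Λ} asz γ` — LITERALLY one run's half of the `htilt` conjunct of
`…N19TameConditionedHellingerLetterAlongK.affinityDefectLetter_of_tameTilts` with `𝔅 := 2Σ asz` (`φ` = the difference of the tree's `polymerLogZ` at `s` and at `0`). -/
theorem tiltLetter_of_kpMargin [Std.Refl inc] [Std.Symm inc] (Λ : Finset P) (a u asz : P → ℝ) (ha : ∀ γ ∈ Λ, 0 < a γ)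
    {r : ℝ} (hr : 0 ≤ r)
    (hKPw : ∀ γ ∈ Λ, ∑ γ' ∈ Λ with inc γ' γ, a γ' * Real.exp (r * |u γ'|) * Real.exp (asz γ') ≤ asz γ)
    (h : Finset P → ℝ) (hh : ∀ X ∈ Λ.powerset.filter (fun X => IsCompatible inc X), h X = ∑ γ ∈ X, u γ) :
    ∃ φ : ℂ → ℂ, DifferentiableOn ℂ φ (Metric.closedBall 0 r) ∧
      (∀ s ∈ Metric.closedBall (0:ℂ) r, Complex.exp (φ s)
        = (∑ X ∈ Λ.powerset with IsCompatible inc X, ((∏ γ ∈ X, a γ : ℝ) : ℂ) * Complex.exp (s * (h X : ℂ)))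
            / ∑ X ∈ Λ.powerset with IsCompatible inc X, ((∏ γ ∈ X, a γ : ℝ) : ℂ)) ∧
      (∀ s ∈ Metric.closedBall (0:ℂ) r, ‖φ s‖ ≤ 2 * ∑ γ ∈ Λ, asz γ) := by
  set w : P → ℂ → ℂ := fun γ s => (a γ : ℂ) * Complex.exp (s * (u γ : ℂ)) with hwdef
  have hw : ∀ γ ∈ Λ, DifferentiableOn ℂ (w γ) (Metric.closedBall 0 r) := fun γ _ =>
    ((differentiable_const _).mul ((differentiable_id.mul (differentiable_const _)).cexp)).differentiableOn
  have hKP : IsKPOn inc w asz Λ (Metric.closedBall 0 r) := isKPOn_tilt inc Λ a u asz (fun γ hγ => (ha γ hγ).le) hKPw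
  obtain ⟨hdiff, hbd⟩ := logZ_differentiableOn_and_bound (inc := inc) hw hKP
  have h0 : (0:ℂ) ∈ Metric.closedBall (0:ℂ) r := Metric.mem_closedBall_self hr
  -- the class sum at `s` is `cZ … s`, at `0` it is `cZ … 0`
  have e0 : ∑ X ∈ Λ.powerset with IsCompatible inc X, ((∏ γ ∈ X, a γ : ℝ) : ℂ) = cZ inc w Λ 0 := by
    have := tilt_classSum_eq_cZ inc Λ a u 0
    simpa only [zero_mul, Complex.exp_zero, mul_one] using this
  refine ⟨fun s => polymerLogZ inc (fun γ => w γ s) Λ - polymerLogZ inc (fun γ => w γ 0) Λ, hdiff.sub_const _, ?_, ?_⟩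
  · intro s hs
    rw [Complex.exp_sub, exp_polymerLogZ_of_kp (hKP s hs) (Finset.Subset.refl Λ),
      exp_polymerLogZ_of_kp (hKP 0 h0) (Finset.Subset.refl Λ), tilt_classSum_eq_cZ_of_additive inc Λ a u h hh s, e0]
    rfl
  · intro s hs
    calc ‖polymerLogZ inc (fun γ => w γ s) Λ - polymerLogZ inc (fun γ => w γ 0) Λ‖
        ≤ ‖polymerLogZ inc (fun γ => w γ s) Λ‖ + ‖polymerLogZ inc (fun γ => w γ 0) Λ‖ := norm_sub_le _ _
      _ ≤ (∑ γ ∈ Λ, asz γ) + ∑ γ ∈ Λ, asz γ := add_le_add (hbd s hs) (hbd 0 h0)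
      _ = 2 * ∑ γ ∈ Λ, asz γ := by ring

/-! ## §4 R2's tame class set for a keyed gas: the compatible families AVOIDING the over-aged polymers [algebra] -/

/-- **THE TAME FAMILIES ARE THE COMPATIBLE SUB-FAMILIES OF `Λ ∖ O`** [algebra]: with `W :=` the compatible families MEETING the over-aged set `O`, the tame
class set `T ∖ W` of `…N19TameConditionedHellingerLetter` IS the class set of the hard-core gas on `Λ ∖ O` — a sub-gas of a hard-core gas is a hard-core gas,
so §1–§3 apply THERE (CRIT-1 g5's sheet, check 4). -/
theorem tameFamilies_eq_compatible_sdiff (Λ O : Finset P) :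
    (Λ.powerset.filter (fun X => IsCompatible inc X)) \ ((Λ.powerset.filter (fun X => IsCompatible inc X)).filter (fun X => ¬ Disjoint X O))
      = (Λ \ O).powerset.filter (fun X => IsCompatible inc X) := by
  ext X
  simp only [Finset.mem_sdiff, Finset.mem_filter, Finset.mem_powerset, not_and, not_not, Finset.subset_sdiff]
  constructor
  · rintro ⟨⟨hXΛ, hc⟩, hd⟩
    exact ⟨⟨hXΛ, hd ⟨hXΛ, hc⟩⟩, hc⟩
  · rintro ⟨⟨hXΛ, hd⟩, hc⟩
    exact ⟨⟨hXΛ, hc⟩, fun _ => hd⟩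

/-- The wild families are a subset of the class set [bookkeeping]. -/
theorem wildFamilies_subset (Λ O : Finset P) :
    (Λ.powerset.filter (fun X => IsCompatible inc X)).filter (fun X => ¬ Disjoint X O)
      ⊆ Λ.powerset.filter (fun X => IsCompatible inc X) :=
  Finset.filter_subset _ _

/-! ## §5 ONE `(K,t)`: wild mass + two one-run KP margins on the tame sub-gas ⇒ the Hellinger letter [folklore] -/

/-- **★★★ THE ONE-`(K,t)` HELLINGER LETTER OF A KEYED GAS FROM WILD MASS AND TWO ONE-RUN KP MARGINS** [folklore; = `…AlongK.one_sub_affinity_classLaw_le_wildMass_add_tameTilts`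
with its `hexpA ∕ hexpB ∕ hbA ∕ hbB` binders DISCHARGED by §3 on the tame sub-gas `Λ ∖ O`].  BOTH runs' keyed class weights multiplicative over the SAME finite
polymer family `Λ` (`A_X = ∏ a_γ`, `B_X = ∏ b_γ`, `a, b > 0` — the abstract form of (KR)), an over-aged set `O ⊆ Λ` (its families = R2's wild set), for each
run a weighted real KP margin on `Λ ∖ O` at radius `r > 0` absorbing `e^{r·|log b_γ − log a_γ|}` (the abstract form of (V‑b): `r = r₀∕η`), and the tame regime
`1 − 𝒜_tame ≤ 1∕16`.  Then, with `T` the compatible families of `Λ` and `p_A = A∕Σ_T A`, `p_B = B∕Σ_T B`: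
`1 − Σ_T √(p_A p_B) ≤ max(p_A(wild), p_B(wild)) + (Σ_{Λ∖O} asz_A + Σ_{Λ∖O} asz_B)∕r²`. -/
theorem one_sub_affinity_keyedGas_le_wildMass_add_kpMargins [Std.Refl inc] [Std.Symm inc] (Λ O : Finset P)
    (a b aszA aszB : P → ℝ) (ha : ∀ γ ∈ Λ, 0 < a γ) (hb : ∀ γ ∈ Λ, 0 < b γ) {r : ℝ} (hr : 0 < r)
    (hKPa : ∀ γ ∈ Λ \ O, ∑ γ' ∈ (Λ \ O) with inc γ' γ,
      a γ' * Real.exp (r * |Real.log (b γ') - Real.log (a γ')|) * Real.exp (aszA γ') ≤ aszA γ)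
    (hKPb : ∀ γ ∈ Λ \ O, ∑ γ' ∈ (Λ \ O) with inc γ' γ,
      b γ' * Real.exp (r * |Real.log (b γ') - Real.log (a γ')|) * Real.exp (aszB γ') ≤ aszB γ)
    (hreg : 1 - ∑ X ∈ (Λ \ O).powerset with IsCompatible inc X,
        Real.sqrt (((∏ γ ∈ X, a γ) / ∑ Y ∈ (Λ \ O).powerset with IsCompatible inc Y, ∏ γ ∈ Y, a γ)
          * ((∏ γ ∈ X, b γ) / ∑ Y ∈ (Λ \ O).powerset with IsCompatible inc Y, ∏ γ ∈ Y, b γ)) ≤ 1 / 16) :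
    1 - ∑ X ∈ Λ.powerset with IsCompatible inc X,
        Real.sqrt (((∏ γ ∈ X, a γ) / ∑ Y ∈ Λ.powerset with IsCompatible inc Y, ∏ γ ∈ Y, a γ)
          * ((∏ γ ∈ X, b γ) / ∑ Y ∈ Λ.powerset with IsCompatible inc Y, ∏ γ ∈ Y, b γ))
      ≤ max ((∑ X ∈ (Λ.powerset.filter (fun X => IsCompatible inc X)).filter (fun X => ¬ Disjoint X O), ∏ γ ∈ X, a γ)
              / ∑ Y ∈ Λ.powerset with IsCompatible inc Y, ∏ γ ∈ Y, a γ)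
            ((∑ X ∈ (Λ.powerset.filter (fun X => IsCompatible inc X)).filter (fun X => ¬ Disjoint X O), ∏ γ ∈ X, b γ)
              / ∑ Y ∈ Λ.powerset with IsCompatible inc Y, ∏ γ ∈ Y, b γ)
        + ((∑ γ ∈ Λ \ O, aszA γ) + ∑ γ ∈ Λ \ O, aszB γ) / r ^ 2 := by
  set T := Λ.powerset.filter (fun X => IsCompatible inc X) with hTdef
  set W := T.filter (fun X => ¬ Disjoint X O) with hWdef
  have hW : W ⊆ T := Finset.filter_subset _ _
  have hTW : T \ W = (Λ \ O).powerset.filter (fun X => IsCompatible inc X) := tameFamilies_eq_compatible_sdiff inc Λ O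
  have hXΛ : ∀ X ∈ T, X ⊆ Λ := fun X hX => Finset.mem_powerset.1 (Finset.mem_filter.1 hX).1
  have hA : ∀ X ∈ T, 0 < ∏ γ ∈ X, a γ := fun X hX => Finset.prod_pos fun γ hγ => ha γ (hXΛ X hX hγ)
  have hB : ∀ X ∈ T, 0 < ∏ γ ∈ X, b γ := fun X hX => Finset.prod_pos fun γ hγ => hb γ (hXΛ X hX hγ)
  have ha' : ∀ γ ∈ Λ \ O, 0 < a γ := fun γ hγ => ha γ (Finset.sdiff_subset hγ)
  have hb' : ∀ γ ∈ Λ \ O, 0 < b γ := fun γ hγ => hb γ (Finset.sdiff_subset hγ)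
  -- the two-run increment `log B − log A` is additive on the compatible families of `Λ ∖ O` (§1)
  have hh : ∀ X ∈ (Λ \ O).powerset.filter (fun X => IsCompatible inc X),
      (fun X => Real.log (∏ γ ∈ X, b γ) - Real.log (∏ γ ∈ X, a γ)) X = ∑ γ ∈ X, (Real.log (b γ) - Real.log (a γ)) := by
    intro X hX
    have hXs : X ⊆ Λ \ O := Finset.mem_powerset.1 (Finset.mem_filter.1 hX).1
    exact logRatio_prod_eq_sum X (fun γ hγ => ha' γ (hXs hγ)) (fun γ hγ => hb' γ (hXs hγ))
  -- the two tame tilt letters from the two one-run KP margins (§3)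
  obtain ⟨φA, hφA, heA, hbA⟩ := tiltLetter_of_kpMargin inc (Λ \ O) a (fun γ => Real.log (b γ) - Real.log (a γ)) aszA
    ha' hr.le hKPa (fun X => Real.log (∏ γ ∈ X, b γ) - Real.log (∏ γ ∈ X, a γ)) hh
  obtain ⟨φB, hφB, heB, hbB⟩ := tiltLetter_of_kpMargin inc (Λ \ O) b (fun γ => Real.log (b γ) - Real.log (a γ)) aszB
    hb' hr.le hKPb (fun X => Real.log (∏ γ ∈ X, b γ) - Real.log (∏ γ ∈ X, a γ)) hh
  -- R2 ∘ tame tilts (FILE 1b §1), the tame class set rewritten as the sub-gas on `Λ ∖ O` (§4)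
  have key := one_sub_affinity_classLaw_le_wildMass_add_tameTilts (T := T) (W := W)
    (A := fun X => ∏ γ ∈ X, a γ) (B := fun X => ∏ γ ∈ X, b γ) hW hA hB hr φA φB hφA hφB
    (fun s hs => by rw [hTW]; exact heA s hs) (fun s hs => by rw [hTW]; exact heB s hs) hbA hbB
    (by rw [hTW]; exact hreg)
  have e : (2 * ∑ γ ∈ Λ \ O, aszA γ + 2 * ∑ γ ∈ Λ \ O, aszB γ) / (2 * r ^ 2)
      = ((∑ γ ∈ Λ \ O, aszA γ) + ∑ γ ∈ Λ \ O, aszB γ) / r ^ 2 := by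
    rw [div_eq_div_iff (by positivity) (by positivity)]; ring
  rw [e] at key
  exact key

/-! ## §6 ALONG `K`: the (H) letter from (KR) + (V‑a) + (V‑b) in abstract form [folklore] -/

/-- **★★ THE AFFINITY-DEFECT LETTER OF A KEYED GAS FROM WILD MASSES AND ONE-RUN KP MARGINS, SUMMED OVER KEYS** [folklore; =
`…AlongK.affinityDefectLetter_of_tameTilts` with `htilt` DISCHARGED by §3 and the tame class sets read through §4].  Per key `K` and source `|t| ≤ l₀`:
a finite polymer family `Λ_K`, BOTH runs' activities `a, b > 0` on it (keyed class weights multiplicative — (KR)), an over-aged set `O_{K,t}`, bounds `wm_K`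
on both ONE-RUN wild masses with `Σ√wm_K < ∞` ((V‑a)), radii `r_K > 0` with `Σ 1∕r_K < ∞` and, for each run, a weighted real KP margin on `Λ_K ∖ O_{K,t}` at
radius `r_K` absorbing `e^{r_K|log b_γ − log a_γ|}` ((V‑b) spent on the radius), size functions with `Σ_{Λ_K∖O} asz ≤ 𝔄` (ONE bound, both runs, all keys),
and the tame regime from `K₀` on.  Then `∃ η ≥ 0`, `Σ_K √η_K < ∞`, and for all `K`, `|t| ≤ l₀` the class laws of the two keyed gases satisfy
`1 − Σ_T √(p_A p_B) ≤ η_K` — the (H) letter consumed by the landed class-law ∕ TV roads.  Nothing else enters. -/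
theorem affinityDefectLetter_of_kpMargins [Std.Refl inc] [Std.Symm inc] {l₀ : ℝ}
    (Λ : ℕ → Finset P) (O : ℕ → ℝ → Finset P) (a b aszA aszB : ℕ → ℝ → P → ℝ)
    (ha : ∀ K t, |t| ≤ l₀ → ∀ γ ∈ Λ K, 0 < a K t γ) (hb : ∀ K t, |t| ≤ l₀ → ∀ γ ∈ Λ K, 0 < b K t γ)
    (wm : ℕ → ℝ) (hwm : ∀ K, 0 ≤ wm K)
    (hwildA : ∀ K t, |t| ≤ l₀ →
      (∑ X ∈ ((Λ K).powerset.filter (fun X => IsCompatible inc X)).filter (fun X => ¬ Disjoint X (O K t)), ∏ γ ∈ X, a K t γ)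
        / (∑ Y ∈ (Λ K).powerset with IsCompatible inc Y, ∏ γ ∈ Y, a K t γ) ≤ wm K)
    (hwildB : ∀ K t, |t| ≤ l₀ →
      (∑ X ∈ ((Λ K).powerset.filter (fun X => IsCompatible inc X)).filter (fun X => ¬ Disjoint X (O K t)), ∏ γ ∈ X, b K t γ)
        / (∑ Y ∈ (Λ K).powerset with IsCompatible inc Y, ∏ γ ∈ Y, b K t γ) ≤ wm K)
    (hws : Summable fun K => Real.sqrt (wm K))
    (r : ℕ → ℝ) (hr : ∀ K, 0 < r K) (hrs : Summable fun K => 1 / r K)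
    {𝔄 : ℝ} (h𝔄 : 0 ≤ 𝔄)
    (h𝔄A : ∀ K t, |t| ≤ l₀ → ∑ γ ∈ Λ K \ O K t, aszA K t γ ≤ 𝔄) (h𝔄B : ∀ K t, |t| ≤ l₀ → ∑ γ ∈ Λ K \ O K t, aszB K t γ ≤ 𝔄)
    (hKPa : ∀ K t, |t| ≤ l₀ → ∀ γ ∈ Λ K \ O K t, ∑ γ' ∈ (Λ K \ O K t) with inc γ' γ,
      a K t γ' * Real.exp (r K * |Real.log (b K t γ') - Real.log (a K t γ')|) * Real.exp (aszA K t γ') ≤ aszA K t γ)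
    (hKPb : ∀ K t, |t| ≤ l₀ → ∀ γ ∈ Λ K \ O K t, ∑ γ' ∈ (Λ K \ O K t) with inc γ' γ,
      b K t γ' * Real.exp (r K * |Real.log (b K t γ') - Real.log (a K t γ')|) * Real.exp (aszB K t γ') ≤ aszB K t γ)
    (K₀ : ℕ) (hreg : ∀ K, K₀ ≤ K → ∀ t, |t| ≤ l₀ →
      1 - ∑ X ∈ (Λ K \ O K t).powerset with IsCompatible inc X,
        Real.sqrt (((∏ γ ∈ X, a K t γ) / ∑ Y ∈ (Λ K \ O K t).powerset with IsCompatible inc Y, ∏ γ ∈ Y, a K t γ)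
          * ((∏ γ ∈ X, b K t γ) / ∑ Y ∈ (Λ K \ O K t).powerset with IsCompatible inc Y, ∏ γ ∈ Y, b K t γ)) ≤ 1 / 16) :
    ∃ η : ℕ → ℝ, (∀ K, 0 ≤ η K) ∧ Summable (fun K => Real.sqrt (η K)) ∧
      ∀ K t, |t| ≤ l₀ →
        1 - ∑ X ∈ (Λ K).powerset with IsCompatible inc X,
          Real.sqrt (((∏ γ ∈ X, a K t γ) / ∑ Y ∈ (Λ K).powerset with IsCompatible inc Y, ∏ γ ∈ Y, a K t γ)
            * ((∏ γ ∈ X, b K t γ) / ∑ Y ∈ (Λ K).powerset with IsCompatible inc Y, ∏ γ ∈ Y, b K t γ)) ≤ η K := by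
  -- class-set data of the keyed gases
  have hW : ∀ K t, ((Λ K).powerset.filter (fun X => IsCompatible inc X)).filter (fun X => ¬ Disjoint X (O K t))
      ⊆ (Λ K).powerset.filter (fun X => IsCompatible inc X) := fun K t => Finset.filter_subset _ _
  have hXΛ : ∀ K, ∀ X ∈ (Λ K).powerset.filter (fun X => IsCompatible inc X), X ⊆ Λ K :=
    fun K X hX => Finset.mem_powerset.1 (Finset.mem_filter.1 hX).1
  have hA : ∀ K t, |t| ≤ l₀ → ∀ X ∈ (Λ K).powerset.filter (fun X => IsCompatible inc X), 0 < ∏ γ ∈ X, a K t γ :=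
    fun K t ht X hX => Finset.prod_pos fun γ hγ => ha K t ht γ (hXΛ K X hX hγ)
  have hB : ∀ K t, |t| ≤ l₀ → ∀ X ∈ (Λ K).powerset.filter (fun X => IsCompatible inc X), 0 < ∏ γ ∈ X, b K t γ :=
    fun K t ht X hX => Finset.prod_pos fun γ hγ => hb K t ht γ (hXΛ K X hX hγ)
  -- the two tame tilt letters at every `(K,t)` (§3 on `Λ K ∖ O K t`), transported to the tame class set (§4)
  have htilt : ∀ K t, |t| ≤ l₀ → ∃ φA φB : ℂ → ℂ,
      DifferentiableOn ℂ φA (Metric.closedBall 0 (r K)) ∧ DifferentiableOn ℂ φB (Metric.closedBall 0 (r K)) ∧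
      (∀ s ∈ Metric.closedBall (0:ℂ) (r K), Complex.exp (φA s)
        = (∑ τ ∈ ((Λ K).powerset.filter (fun X => IsCompatible inc X))
              \ ((Λ K).powerset.filter (fun X => IsCompatible inc X)).filter (fun X => ¬ Disjoint X (O K t)),
            ((∏ γ ∈ τ, a K t γ : ℝ) : ℂ)
              * Complex.exp (s * ((Real.log (∏ γ ∈ τ, b K t γ) - Real.log (∏ γ ∈ τ, a K t γ) : ℝ) : ℂ)))
          / ∑ τ ∈ ((Λ K).powerset.filter (fun X => IsCompatible inc X))
              \ ((Λ K).powerset.filter (fun X => IsCompatible inc X)).filter (fun X => ¬ Disjoint X (O K t)),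
            ((∏ γ ∈ τ, a K t γ : ℝ) : ℂ)) ∧
      (∀ s ∈ Metric.closedBall (0:ℂ) (r K), Complex.exp (φB s)
        = (∑ τ ∈ ((Λ K).powerset.filter (fun X => IsCompatible inc X))
              \ ((Λ K).powerset.filter (fun X => IsCompatible inc X)).filter (fun X => ¬ Disjoint X (O K t)),
            ((∏ γ ∈ τ, b K t γ : ℝ) : ℂ)
              * Complex.exp (s * ((Real.log (∏ γ ∈ τ, b K t γ) - Real.log (∏ γ ∈ τ, a K t γ) : ℝ) : ℂ)))
          / ∑ τ ∈ ((Λ K).powerset.filter (fun X => IsCompatible inc X))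
              \ ((Λ K).powerset.filter (fun X => IsCompatible inc X)).filter (fun X => ¬ Disjoint X (O K t)),
            ((∏ γ ∈ τ, b K t γ : ℝ) : ℂ)) ∧
      (∀ s ∈ Metric.closedBall (0:ℂ) (r K), ‖φA s‖ ≤ 2 * 𝔄) ∧ (∀ s ∈ Metric.closedBall (0:ℂ) (r K), ‖φB s‖ ≤ 2 * 𝔄) := by
    intro K t ht
    have ha' : ∀ γ ∈ Λ K \ O K t, 0 < a K t γ := fun γ hγ => ha K t ht γ (Finset.sdiff_subset hγ)
    have hb' : ∀ γ ∈ Λ K \ O K t, 0 < b K t γ := fun γ hγ => hb K t ht γ (Finset.sdiff_subset hγ)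
    have hh : ∀ X ∈ (Λ K \ O K t).powerset.filter (fun X => IsCompatible inc X),
        (fun X => Real.log (∏ γ ∈ X, b K t γ) - Real.log (∏ γ ∈ X, a K t γ)) X
          = ∑ γ ∈ X, (Real.log (b K t γ) - Real.log (a K t γ)) := by
      intro X hX
      have hXs : X ⊆ Λ K \ O K t := Finset.mem_powerset.1 (Finset.mem_filter.1 hX).1
      exact logRatio_prod_eq_sum X (fun γ hγ => ha' γ (hXs hγ)) (fun γ hγ => hb' γ (hXs hγ))
    obtain ⟨φA, hφA, heA, hbA⟩ := tiltLetter_of_kpMargin inc (Λ K \ O K t) (a K t)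
      (fun γ => Real.log (b K t γ) - Real.log (a K t γ)) (aszA K t) ha' (hr K).le (hKPa K t ht)
      (fun X => Real.log (∏ γ ∈ X, b K t γ) - Real.log (∏ γ ∈ X, a K t γ)) hh
    obtain ⟨φB, hφB, heB, hbB⟩ := tiltLetter_of_kpMargin inc (Λ K \ O K t) (b K t)
      (fun γ => Real.log (b K t γ) - Real.log (a K t γ)) (aszB K t) hb' (hr K).le (hKPb K t ht)
      (fun X => Real.log (∏ γ ∈ X, b K t γ) - Real.log (∏ γ ∈ X, a K t γ)) hh
    refine ⟨φA, φB, hφA, hφB, ?_, ?_, ?_, ?_⟩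
    · intro s hs; rw [tameFamilies_eq_compatible_sdiff]; exact heA s hs
    · intro s hs; rw [tameFamilies_eq_compatible_sdiff]; exact heB s hs
    · intro s hs; exact (hbA s hs).trans (by linarith [h𝔄A K t ht])
    · intro s hs; exact (hbB s hs).trans (by linarith [h𝔄B K t ht])
  have hreg' : ∀ K, K₀ ≤ K → ∀ t, |t| ≤ l₀ →
      1 - ∑ τ ∈ ((Λ K).powerset.filter (fun X => IsCompatible inc X))
              \ ((Λ K).powerset.filter (fun X => IsCompatible inc X)).filter (fun X => ¬ Disjoint X (O K t)),
        Real.sqrt (((∏ γ ∈ τ, a K t γ) / ∑ σ ∈ ((Λ K).powerset.filter (fun X => IsCompatible inc X))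
              \ ((Λ K).powerset.filter (fun X => IsCompatible inc X)).filter (fun X => ¬ Disjoint X (O K t)), ∏ γ ∈ σ, a K t γ)
          * ((∏ γ ∈ τ, b K t γ) / ∑ σ ∈ ((Λ K).powerset.filter (fun X => IsCompatible inc X))
              \ ((Λ K).powerset.filter (fun X => IsCompatible inc X)).filter (fun X => ¬ Disjoint X (O K t)), ∏ γ ∈ σ, b K t γ))
        ≤ 1 / 16 := by
    intro K hK t ht; rw [tameFamilies_eq_compatible_sdiff]; exact hreg K hK t ht
  have h2𝔄 : (0:ℝ) ≤ 2 * 𝔄 := by positivity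
  obtain ⟨η, hη0, hηs, hη⟩ := affinityDefectLetter_of_tameTilts
    (fun K => (Λ K).powerset.filter (fun X => IsCompatible inc X))
    (fun K t X => ∏ γ ∈ X, a K t γ) (fun K t X => ∏ γ ∈ X, b K t γ) hA hB
    (fun K t => ((Λ K).powerset.filter (fun X => IsCompatible inc X)).filter (fun X => ¬ Disjoint X (O K t))) hW
    wm hwm hwildA hwildB hws r hr hrs h2𝔄 htilt K₀ hreg'
  exact ⟨η, hη0, hηs, hη⟩

/-! ## §7 Toy (A6): the hypothesis set of §5 is inhabited — no polymers [folklore] -/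

/-- With NO polymers (`Λ = O = ∅`) the keyed gas has the single empty class with weight `1` for both runs: the KP margins are vacuous, the tame regime reads
`1 − √1·1 ≤ 1∕16`, and §5 returns `0 ≤ 0 + 0` — source-free non-vacuity of the antecedent. -/
theorem toy_noPolymers [Std.Refl inc] [Std.Symm inc] (a b aszA aszB : P → ℝ) {r : ℝ} (hr : 0 < r) :
    1 - ∑ X ∈ (∅ : Finset P).powerset with IsCompatible inc X,
        Real.sqrt (((∏ γ ∈ X, a γ) / ∑ Y ∈ (∅ : Finset P).powerset with IsCompatible inc Y, ∏ γ ∈ Y, a γ)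
          * ((∏ γ ∈ X, b γ) / ∑ Y ∈ (∅ : Finset P).powerset with IsCompatible inc Y, ∏ γ ∈ Y, b γ))
      ≤ max ((∑ X ∈ ((∅ : Finset P).powerset.filter (fun X => IsCompatible inc X)).filter (fun X => ¬ Disjoint X ∅), ∏ γ ∈ X, a γ)
              / ∑ Y ∈ (∅ : Finset P).powerset with IsCompatible inc Y, ∏ γ ∈ Y, a γ)
            ((∑ X ∈ ((∅ : Finset P).powerset.filter (fun X => IsCompatible inc X)).filter (fun X => ¬ Disjoint X ∅), ∏ γ ∈ X, b γ)
              / ∑ Y ∈ (∅ : Finset P).powerset with IsCompatible inc Y, ∏ γ ∈ Y, b γ)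
        + ((∑ γ ∈ (∅ : Finset P) \ ∅, aszA γ) + ∑ γ ∈ (∅ : Finset P) \ ∅, aszB γ) / r ^ 2 := by
  have hT : (∅ : Finset P).powerset.filter (fun X => IsCompatible inc X) = {∅} := by
    rw [Finset.powerset_empty, Finset.filter_singleton,
      if_pos (Literature.Probability.LatticeModels.isCompatible_empty (inc := inc))]
  refine one_sub_affinity_keyedGas_le_wildMass_add_kpMargins inc ∅ ∅ a b aszA aszB (by simp) (by simp) hr (by simp) (by simp) ?_
  rw [Finset.sdiff_self, hT]
  simp

end Summit.QuantumFields.YangMills.BalabanUVNodes.N19TameTiltLetterOfKPMargin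

end
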